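import Literature.NumberTheory.Sieve.HeathBrownCubicTypeIIErrorEV
import Literature.NumberTheory.Sieve.HeathBrownCubicLemma45Pow
import HarnessLib

/-!
# Heath-Brown's Lemma 3.10, §11 p. 68: Cauchy's inequality, `S = S₁ + S₂`, `S₁ ≪ X²(log X)^c`

Support for the proof of **Lemma 3.10** of D. R. Heath-Brown, *Primes represented by `x³ + 2y³`*,
Acta Math. 186 (2001), §11 p. 68:

> "It therefore follows that `S_V = ∑_{α ∈ Q} c_{(α)} ∑_{V < |N(β)| ≤ 2V} F_β ∑_{𝐱 ∈ ℤ², x+y2^{1/3} = αβ} W(𝐱) + O(X^{2−τ/2}(log X)^c)`,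
> where `F_β = f_{(β)}` if `β ∈ Q'`, and `F_β = 0` otherwise. … Since `N(α) ≪ X³/V`, an application of
> Cauchy's inequality yields `∑_α … ≪ (X³/V)^{1/2} S^{1/2}`, where
> `S = ∑_{α ∈ Q} |∑_{V<|N(β)|≤2V} F_β ∑_{x+y2^{1/3} = αβ} W(𝐱)|²`. We proceed to expand the square of the
> sum over `β` to obtain `S = ∑_{β₁,β₂} F_{β₁}F_{β₂} ∑_{𝐱₁,𝐱₂} W(𝐱₁)W(𝐱₂)δ` … We now split `S` as `S₁ + S₂`,
> where `S₁` consists of the terms for which `β₁ = β₂` … Since `F_β ≪ τ(β) log X`, we find that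
> `S₁ ≪ ∑_β F_β² ∑_{𝐱} W(𝐱) ≪ (log X)² ∑_{x,y ≪ X} τ(x + y2^{1/3})³ ≪ X²(log X)^c` by Lemma 4.7."

In coordinates (`α ↔ α̂ = a ∈ ℤ³`, `β ↔ β̂ = b`, `αβ ↔ imulVec a b`, `W ↔ membership of `imulVec a b`
in `boxVec`), all PROVED:

* `boxVec`, `Wab`, `Fb` (`F_β` with the window and the primitivity of `β̂`), `cA` (`c_{(α)}[α̂ primitive]`),
  `cube M` (`|v|_∞ ≤ M`), `Abox = cube (7X/T)` (contains every relevant `α̂`, (11.6)),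
  `Bbox = cube (3T)` (every relevant `β̂`, (11.5)), `innerSum a = ∑_b F_b W(a b)`, `Ssum` (`S`),
  `S1sum`, `S2sum` (`S₁`, `S₂`);
* **`sum_pairSet_eq_sum_sigmaSet`** — the re-indexing `(x, y, β) ↔ (α̂, β̂)` (a bijection between the
  nonzero supports), whence **`mainMV_eq_sum_cA_innerSum`**: `M_V = ∑_a c_a ∑_b F_b W(ab)`;
* **`abs_mainMV_le`** (Cauchy): `|M_V| ≤ (#Abox)^{1/2} S^{1/2}`, with `card_cube_le`
  (`#Abox ≤ (14X/T + 1)³ ≪ X³/V`);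
* **`Ssum_eq_S1_add_S2`** (`S = S₁ + S₂`) and **`S1sum_le`**: `S₁ ≤ 81 ∑_{(x,y) ∈ box} τ(x+y2^{1/3})³`,
  `exists_S1_bound`: `S₁ ≤ C X² (log X)^e` (Lemma 4.7, `A = 3`).

## References

* D. R. Heath-Brown, *Primes represented by `x³ + 2y³`*, Acta Math. 186 (2001), §11 p. 68.
  [cite: HeathBrownActa2001, §11 p. 68]
* G. Harman, *Prime-Detecting Sieves* (2007), §13.8 pp. 279–280. [cite: Harman2007, §13.8]

## Mathlib / tree search

Tree: `HeathBrownCubicTypeIIErrorEV` (`Hprim`, `mainMV`, `gCut`, `abs_gCut_le`,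
`sum_box_idealDivisorCount_pow_le`), `HeathBrownCubicTypeIIGenerators` (`winDivs`, `quo`, `box`),
`HeathBrownCubicWindow` (`imulVec`, `coordElt_imulVec`, `abs_coord_le_of_inWindow`,
`abs_coord_alpha_le`), `HeathBrownCubicLemma47` (Lemma 4.7), `HeathBrownCubicNuSum`
(`sum_le_sum_of_injOn_nonneg`). Mathlib: `Finset.sum_nbij'`, `Real.sum_mul_le_sqrt_mul_sqrt`,
`Finset.sum_product`, `Finset.diag`, `Finset.offDiag`.
-/

noncomputable section

open Finset NumberField

namespace Literature.NumberTheory.Sieve.CubicSieve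

open LFunctions.CubeRootTwoField CubicPrimes

section Defs

variable (X η τ : ℝ) {k : ℕ} (m : Fin k → ℕ) (V T : ℝ) (c : Ideal (𝓞 K) → ℝ)

/-- The coordinate vectors `(x, y, 0)` of the `x + y2^{1/3}`, `(x, y) ∈ box`. [cite: HeathBrownActa2001, §11 p. 67] -/
def boxVec : Finset (ℤ × ℤ × ℤ) := (box X η).image fun xy => ((xy.1 : ℤ), (xy.2 : ℤ), (0 : ℤ))

/-- **`W(αβ)`** in coordinates: the product `α̂ β̂` is an `(x, y, 0)` with `(x, y)` in the box
("`∑_{𝐱 ∈ ℤ², x + y2^{1/3} = αβ} W(𝐱)`", p. 68). [cite: HeathBrownActa2001, §11 p. 68] -/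
def Wab (a b : ℤ × ℤ × ℤ) : Prop := imulVec a b ∈ boxVec X η

/-- `W` is decidable (membership in a finite set). [folklore] -/
instance instDecidableWab (a b : ℤ × ℤ × ℤ) : Decidable (Wab X η a b) := by unfold Wab; infer_instance

open scoped Classical in
/-- **`F_β`** (p. 68: "`F_β = f_{(β)}` if `β ∈ Q'`, and `F_β = 0` otherwise"), here with the cut
`V < N(β) ≤ 2V` inside `g` and `Q'` = primitive `β̂` in the window. [cite: HeathBrownActa2001, §11 p. 68] -/
def Fb (b : ℤ × ℤ × ℤ) : ℝ :=
  if InWindow T (coordElt b) ∧ IsPrimitiveVec b then gCut X τ m V (Ideal.span {coordElt b}) else 0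

open scoped Classical in
/-- `c_{(α)} · [α̂ primitive]` (`α ∈ Q`, the primitive integers). [cite: HeathBrownActa2001, §11 p. 68] -/
def cA (a : ℤ × ℤ × ℤ) : ℝ := if IsPrimitiveVec a then c (Ideal.span {coordElt a}) else 0

/-- The integer cube `|v|_∞ ≤ M`. [folklore] -/
def cube (M : ℝ) : Finset (ℤ × ℤ × ℤ) := Icc (-⌊M⌋) ⌊M⌋ ×ˢ (Icc (-⌊M⌋) ⌊M⌋ ×ˢ Icc (-⌊M⌋) ⌊M⌋)

/-- The range of `α̂`: `|α̂|_∞ ≤ 7X/T` ((11.6), `abs_coord_alpha_le`). [cite: HeathBrownActa2001, §11 (11.6)] -/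
def Abox : Finset (ℤ × ℤ × ℤ) := cube (7 * X / T)

/-- The range of `β̂`: `|β̂|_∞ ≤ 3T = 3V^{1/3}` ((11.5), `abs_coord_le_of_inWindow`). [cite: HeathBrownActa2001, §11 (11.5)] -/
def Bbox : Finset (ℤ × ℤ × ℤ) := cube (3 * T)

/-- **`∑_β F_β W(αβ)`**, the inner sum of Cauchy's inequality. [cite: HeathBrownActa2001, §11 p. 68] -/
def innerSum (a : ℤ × ℤ × ℤ) : ℝ := ∑ b ∈ Bbox T, if Wab X η a b then Fb X τ m V T b else 0

open scoped Classical in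
/-- **`S = ∑_{α ∈ Q} |∑_β F_β W(αβ)|²`** (over primitive `α̂` in `Abox`). [cite: HeathBrownActa2001, §11 p. 68] -/
def Ssum : ℝ := ∑ a ∈ (Abox X T).filter IsPrimitiveVec, innerSum X η τ m V T a ^ 2

open scoped Classical in
/-- **`S₁`**, the diagonal terms `β₁ = β₂` of `S`: `∑_α ∑_β F_β² W(αβ)`. [cite: HeathBrownActa2001, §11 p. 68] -/
def S1sum : ℝ :=
  ∑ a ∈ (Abox X T).filter IsPrimitiveVec, ∑ b ∈ Bbox T, if Wab X η a b then Fb X τ m V T b ^ 2 else 0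

open scoped Classical in
/-- **`S₂`**, the off-diagonal terms `β₁ ≠ β₂` of `S`. [cite: HeathBrownActa2001, §11 p. 68] -/
def S2sum : ℝ :=
  ∑ a ∈ (Abox X T).filter IsPrimitiveVec, ∑ bb ∈ (Bbox T).offDiag,
    if Wab X η a bb.1 ∧ Wab X η a bb.2 then Fb X τ m V T bb.1 * Fb X τ m V T bb.2 else 0

open scoped Classical in
/-- The index set `{(x, y, β)}` of the generator form of `M_V` restricted to `V < N(β) ≤ 2V`. [folklore] -/
def sigmaSet : Finset ((_ : ℕ × ℕ) × 𝓞 K) :=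
  (box X η).sigma fun xy => (winDivs T (pairElt xy)).filter fun β =>
    V < (Ideal.absNorm (Ideal.span {β}) : ℝ) ∧ (Ideal.absNorm (Ideal.span {β}) : ℝ) ≤ 2 * V

open scoped Classical in
/-- The index set `{(α̂, β̂)}`: `α̂β̂ = (x, y, 0)` in the box, `β` in the window, `V < N(β) ≤ 2V`. [folklore] -/
def pairSet : Finset ((ℤ × ℤ × ℤ) × (ℤ × ℤ × ℤ)) :=
  (Abox X T ×ˢ Bbox T).filter fun ab => Wab X η ab.1 ab.2 ∧ InWindow T (coordElt ab.2) ∧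
    V < (Ideal.absNorm (Ideal.span {coordElt ab.2}) : ℝ) ∧ (Ideal.absNorm (Ideal.span {coordElt ab.2}) : ℝ) ≤ 2 * V

end Defs

variable {X η τ V T : ℝ} {k : ℕ} {m : Fin k → ℕ} {c : Ideal (𝓞 K) → ℝ}

/-! ### Membership lemmas -/

/-- Membership in the integer cube. [folklore] -/
theorem mem_cube_iff {M : ℝ} {v : ℤ × ℤ × ℤ} :
    v ∈ cube M ↔ |v.1| ≤ ⌊M⌋ ∧ |v.2.1| ≤ ⌊M⌋ ∧ |v.2.2| ≤ ⌊M⌋ := by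
  simp only [cube, mem_product, mem_Icc, abs_le]

/-- Real coordinate bounds put an integer vector in the cube. [folklore] -/
theorem mem_cube_of_abs_le {M : ℝ} {v : ℤ × ℤ × ℤ} (h1 : |(v.1 : ℝ)| ≤ M) (h2 : |(v.2.1 : ℝ)| ≤ M)
    (h3 : |(v.2.2 : ℝ)| ≤ M) : v ∈ cube M := by
  rw [mem_cube_iff]
  refine ⟨Int.le_floor.mpr ?_, Int.le_floor.mpr ?_, Int.le_floor.mpr ?_⟩
  · rw [Int.cast_abs]; exact h1
  · rw [Int.cast_abs]; exact h2
  · rw [Int.cast_abs]; exact h3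

/-- Conversely, cube membership bounds the real coordinates. [folklore] -/
theorem abs_le_of_mem_cube {M : ℝ} {v : ℤ × ℤ × ℤ} (h : v ∈ cube M) :
    |(v.1 : ℝ)| ≤ M ∧ |(v.2.1 : ℝ)| ≤ M ∧ |(v.2.2 : ℝ)| ≤ M := by
  rw [mem_cube_iff] at h
  have hf : ((⌊M⌋ : ℤ) : ℝ) ≤ M := Int.floor_le M
  refine ⟨?_, ?_, ?_⟩
  · rw [← Int.cast_abs]; exact le_trans (by exact_mod_cast h.1) hf
  · rw [← Int.cast_abs]; exact le_trans (by exact_mod_cast h.2.1) hf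
  · rw [← Int.cast_abs]; exact le_trans (by exact_mod_cast h.2.2) hf

/-- `#cube M ≤ (2M + 1)³` (`M ≥ 0`). [folklore] -/
theorem card_cube_le {M : ℝ} (hM : 0 ≤ M) : (#(cube M) : ℝ) ≤ (2 * M + 1) ^ 3 := by
  have hf0 : 0 ≤ ⌊M⌋ := Int.floor_nonneg.mpr hM
  have hcard : #(Icc (-⌊M⌋) ⌊M⌋) = (2 * ⌊M⌋ + 1).toNat := by
    rw [Int.card_Icc]; congr 1; ring
  have hreal : (#(Icc (-⌊M⌋) ⌊M⌋) : ℝ) ≤ 2 * M + 1 := by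
    rw [hcard]
    have : (((2 * ⌊M⌋ + 1).toNat : ℤ) : ℝ) = ((2 * ⌊M⌋ + 1 : ℤ) : ℝ) := by
      rw [Int.toNat_of_nonneg (by omega)]
    rw [show (((2 * ⌊M⌋ + 1).toNat : ℕ) : ℝ) = (((2 * ⌊M⌋ + 1).toNat : ℤ) : ℝ) by norm_cast, this]
    push_cast
    linarith [Int.floor_le M]
  rw [cube, card_product, card_product]
  push_cast
  have h0 : (0 : ℝ) ≤ #(Icc (-⌊M⌋) ⌊M⌋) := by positivity
  calc (#(Icc (-⌊M⌋) ⌊M⌋) : ℝ) * (#(Icc (-⌊M⌋) ⌊M⌋) * #(Icc (-⌊M⌋) ⌊M⌋))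
      ≤ (2 * M + 1) * ((2 * M + 1) * (2 * M + 1)) := by gcongr
    _ = (2 * M + 1) ^ 3 := by ring

/-- Membership in `boxVec`. [folklore] -/
theorem mem_boxVec_iff {v : ℤ × ℤ × ℤ} :
    v ∈ boxVec X η ↔ ∃ xy ∈ box X η, ((xy.1 : ℤ), (xy.2 : ℤ), (0 : ℤ)) = v := by
  rw [boxVec, mem_image]

/-- `coordVec (coordElt a * coordElt b) = imulVec a b`. [folklore] -/
theorem coordVec_coordElt_mul (a b : ℤ × ℤ × ℤ) : coordVec (coordElt a * coordElt b) = imulVec a b := by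
  rw [← coordElt_imulVec, coordVec_coordElt]

/-- For `β` in the window, `N((β)) = normForm(β̂)` (the norm form is positive as `σ₁(β) > 0`). [folklore] -/
theorem absNorm_eq_normForm_of_inWindow {T : ℝ} (hT : 0 < T) {b : ℤ × ℤ × ℤ} (hw : InWindow T (coordElt b)) :
    (Ideal.absNorm (Ideal.span {coordElt b}) : ℝ) = normForm (castVec b) := by
  rw [absNorm_span_coordElt_real]
  have hell : 0 < ell (castVec b) := by
    have := hw.1; rw [ellO_coordElt] at this; linarith
  have hN : 0 ≤ normForm (castVec b) := by
    rw [← ell_mul_quadQ]; exact mul_nonneg hell.le (quadQ_nonneg _)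
  exact abs_of_nonneg hN

/-! ### The re-indexing `(x, y, β) ↔ (α̂, β̂)` -/

/-- Back from `(x, y, 0) ∈ ℤ³` to `(x, y) ∈ ℕ²`. [folklore] -/
def unbox (v : ℤ × ℤ × ℤ) : ℕ × ℕ := (v.1.toNat, v.2.1.toNat)

/-- `unbox (x, y, 0) = (x, y)`. [folklore] -/
@[simp] theorem unbox_natCast (xy : ℕ × ℕ) : unbox ((xy.1 : ℤ), (xy.2 : ℤ), (0 : ℤ)) = xy := by
  simp [unbox]

/-- The forward map `(x, y, β) ↦ ((γ/β)^, β̂)`. [folklore] -/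
def phiMap (s : (_ : ℕ × ℕ) × 𝓞 K) : (ℤ × ℤ × ℤ) × (ℤ × ℤ × ℤ) :=
  (coordVec (quo (pairElt s.1) s.2), coordVec s.2)

/-- The backward map `(α̂, β̂) ↦ (unbox (α̂β̂), β)`. [folklore] -/
def psiMap (ab : (ℤ × ℤ × ℤ) × (ℤ × ℤ × ℤ)) : (_ : ℕ × ℕ) × 𝓞 K :=
  ⟨unbox (imulVec ab.1 ab.2), coordElt ab.2⟩

open scoped Classical in
/-- Unpacking membership in `sigmaSet`. [folklore] -/
theorem mem_sigmaSet_iff (hX : 0 ≤ X) (hT : 0 < T) {s : (_ : ℕ × ℕ) × 𝓞 K} :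
    s ∈ sigmaSet X η V T ↔ s.1 ∈ box X η ∧ InWindow T s.2 ∧ s.2 ∣ pairElt s.1 ∧
      V < (Ideal.absNorm (Ideal.span {s.2}) : ℝ) ∧ (Ideal.absNorm (Ideal.span {s.2}) : ℝ) ≤ 2 * V := by
  classical
  rw [sigmaSet, mem_sigma, mem_filter]
  constructor
  · rintro ⟨hxy, hβ, h1, h2⟩
    have hx1 := (one_le_of_mem_box hX hxy).1
    rw [mem_winDivs_iff hT (pairElt_ne_zero (by omega))] at hβ
    exact ⟨hxy, hβ.1, hβ.2, h1, h2⟩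
  · rintro ⟨hxy, hw, hdvd, h1, h2⟩
    have hx1 := (one_le_of_mem_box hX hxy).1
    refine ⟨hxy, ?_, h1, h2⟩
    rw [mem_winDivs_iff hT (pairElt_ne_zero (by omega))]
    exact ⟨hw, hdvd⟩

open scoped Classical in
/-- Unpacking membership in `pairSet`. [folklore] -/
theorem mem_pairSet_iff {ab : (ℤ × ℤ × ℤ) × (ℤ × ℤ × ℤ)} :
    ab ∈ pairSet X η V T ↔ (ab.1 ∈ Abox X T ∧ ab.2 ∈ Bbox T) ∧ Wab X η ab.1 ab.2 ∧
      InWindow T (coordElt ab.2) ∧ V < (Ideal.absNorm (Ideal.span {coordElt ab.2}) : ℝ) ∧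
        (Ideal.absNorm (Ideal.span {coordElt ab.2}) : ℝ) ≤ 2 * V := by
  classical
  rw [pairSet, mem_filter, mem_product]

/-- `φ` followed by `ψ` on `sigmaSet` data: `imulVec` of `φ(s)` is `(x, y, 0)`. [folklore] -/
theorem imulVec_phiMap {s : (_ : ℕ × ℕ) × 𝓞 K} (hdvd : s.2 ∣ pairElt s.1) :
    imulVec (phiMap s).1 (phiMap s).2 = ((s.1.1 : ℤ), (s.1.2 : ℤ), (0 : ℤ)) := by
  rw [phiMap]
  simp only
  rw [← coordVec_mul, mul_comm, ← eq_mul_quo hdvd, pairElt_eq_coordElt, coordVec_coordElt]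

open scoped Classical in
/-- `φ` maps `sigmaSet` into `pairSet` ((11.5), (11.6) put `β̂`, `α̂` in the boxes). [cite: HeathBrownActa2001, §11 p. 69] -/
theorem phiMap_mem_pairSet (hX : 0 < X) (hη1 : η ≤ 1) (hT : 0 < T) (hTV : T ^ 3 = V)
    {s : (_ : ℕ × ℕ) × 𝓞 K} (hs : s ∈ sigmaSet X η V T) : phiMap s ∈ pairSet X η V T := by
  classical
  rw [mem_sigmaSet_iff hX.le hT] at hs
  obtain ⟨hxy, hw, hdvd, hN1, hN2⟩ := hs
  have hmul := imulVec_phiMap hdvd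
  have hβb : coordElt (phiMap s).2 = s.2 := by rw [phiMap]; exact coordElt_coordVec _
  have hwb : InWindow T (coordElt (phiMap s).2) := by rw [hβb]; exact hw
  have hNb := absNorm_eq_normForm_of_inWindow hT hwb
  rw [hβb] at hNb
  have hell1 : T < ell (castVec (phiMap s).2) := by have := hwb.1; rwa [ellO_coordElt] at this
  have hell2 : ell (castVec (phiMap s).2) ≤ unitE * T := by have := hwb.2; rwa [ellO_coordElt] at this
  have hNf1 : V < normForm (castVec (phiMap s).2) := by rw [← hNb]; exact hN1
  have hNf2 : normForm (castVec (phiMap s).2) ≤ 2 * V := by rw [← hNb]; exact hN2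
  obtain ⟨b1, b2, b3⟩ := abs_coord_le_of_inWindow hT hTV hell1 hell2 hNf2
  have hmulR : mulVec (castVec (phiMap s).1) (castVec (phiMap s).2) = ((s.1.1 : ℝ), (s.1.2 : ℝ), 0) := by
    rw [← castVec_imulVec, hmul]; simp [castVec]
  have hxy' := hxy
  rw [mem_box_iff] at hxy'
  obtain ⟨hx1', hx2', hy1', hy2'⟩ := hxy'
  obtain ⟨a1, a2, a3⟩ := abs_coord_alpha_le hX hT hTV hell1 hell2 hNf1 hmulR hx1' (by nlinarith)
    hy1' (by nlinarith)
  rw [mem_pairSet_iff]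
  refine ⟨⟨mem_cube_of_abs_le a1 a2 a3, mem_cube_of_abs_le b1 b2 b3⟩, ?_, hwb, ?_, ?_⟩
  · rw [Wab, hmul, mem_boxVec_iff]; exact ⟨s.1, hxy, rfl⟩
  · rw [hβb]; exact hN1
  · rw [hβb]; exact hN2

open scoped Classical in
/-- `ψ` maps `pairSet` into `sigmaSet`. [folklore] -/
theorem psiMap_mem_sigmaSet (hX : 0 < X) (hT : 0 < T) {ab : (ℤ × ℤ × ℤ) × (ℤ × ℤ × ℤ)}
    (hab : ab ∈ pairSet X η V T) : psiMap ab ∈ sigmaSet X η V T := by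
  classical
  rw [mem_pairSet_iff] at hab
  obtain ⟨-, hW, hw, hN1, hN2⟩ := hab
  obtain ⟨xy, hxy, heq⟩ := mem_boxVec_iff.mp hW
  have h1 : psiMap ab = ⟨xy, coordElt ab.2⟩ := by rw [psiMap, ← heq, unbox_natCast]
  rw [h1, mem_sigmaSet_iff hX.le hT]
  refine ⟨hxy, hw, ⟨coordElt ab.1, ?_⟩, hN1, hN2⟩
  rw [pairElt_eq_coordElt, heq, coordElt_imulVec, mul_comm]

open scoped Classical in
/-- `ψ ∘ φ = id` on `sigmaSet`. [folklore] -/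
theorem psiMap_phiMap (hX : 0 ≤ X) (hT : 0 < T) {s : (_ : ℕ × ℕ) × 𝓞 K} (hs : s ∈ sigmaSet X η V T) :
    psiMap (phiMap s) = s := by
  classical
  rw [mem_sigmaSet_iff hX hT] at hs
  obtain ⟨xy, β⟩ := s
  obtain ⟨-, -, hdvd, -, -⟩ := hs
  have hmul := imulVec_phiMap (s := ⟨xy, β⟩) hdvd
  rw [psiMap, hmul, unbox_natCast]
  simp only [phiMap, coordElt_coordVec]

open scoped Classical in
/-- `φ ∘ ψ = id` on `pairSet`. [folklore] -/
theorem phiMap_psiMap (hT : 0 < T) {ab : (ℤ × ℤ × ℤ) × (ℤ × ℤ × ℤ)} (hab : ab ∈ pairSet X η V T) :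
    phiMap (psiMap ab) = ab := by
  classical
  rw [mem_pairSet_iff] at hab
  obtain ⟨-, hW, hw, -, -⟩ := hab
  obtain ⟨xy, hxy, heq⟩ := mem_boxVec_iff.mp hW
  have hb0 : coordElt ab.2 ≠ 0 := ne_zero_of_inWindow hT hw
  have h1 : psiMap ab = ⟨xy, coordElt ab.2⟩ := by rw [psiMap, ← heq, unbox_natCast]
  rw [h1, phiMap]
  simp only
  have hγ : pairElt xy = coordElt ab.1 * coordElt ab.2 := by
    rw [pairElt_eq_coordElt, heq, coordElt_imulVec]
  rw [hγ, quo_mul_self hb0, coordVec_coordElt, coordVec_coordElt]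

open scoped Classical in
/-- **The re-indexing bijection** between `{(x, y, β) : (x,y) ∈ box, β ∈ winDivs T (x+y2^{1/3}), V < N(β) ≤ 2V}`
and `{(α̂, β̂) ∈ Abox × Bbox : α̂β̂ = (x, y, 0), β in the window, V < N(β) ≤ 2V}`, `(x, y, β) ↦ ((γ/β)^, β̂)`:
for every function `Ψ`, `∑_{pairSet} Ψ(α̂, β̂) = ∑_{sigmaSet} Ψ(φ(x, y, β))` (`0 < X`, `η ≤ 1`,
`T > 0`, `T³ = V`). [cite: HeathBrownActa2001, §11 p. 68] -/
theorem sum_pairSet_eq_sum_sigmaSet (hX : 0 < X) (hη1 : η ≤ 1) (hT : 0 < T) (hTV : T ^ 3 = V)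
    (Ψ : (ℤ × ℤ × ℤ) × (ℤ × ℤ × ℤ) → ℝ) :
    ∑ ab ∈ pairSet X η V T, Ψ ab = ∑ s ∈ sigmaSet X η V T, Ψ (phiMap s) := by
  classical
  symm
  refine Finset.sum_nbij' phiMap psiMap (fun s hs => ?_) (fun ab hab => ?_) (fun s hs => ?_)
    (fun ab hab => ?_) (fun s _ => rfl)
  · exact phiMap_mem_pairSet hX hη1 hT hTV hs
  · exact psiMap_mem_sigmaSet hX hT hab
  · exact psiMap_phiMap hX.le hT hs
  · exact phiMap_psiMap hT hab

/-! ### `M_V = ∑_α c_α ∑_β F_β W(αβ)` -/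

open scoped Classical in
/-- `sigmaSet` as a filter of the full sigma-set over `winDivs`. [folklore] -/
theorem sigmaSet_eq_filter :
    sigmaSet X η V T = ((box X η).sigma fun xy => winDivs T (pairElt xy)).filter fun s =>
      V < (Ideal.absNorm (Ideal.span {s.2}) : ℝ) ∧ (Ideal.absNorm (Ideal.span {s.2}) : ℝ) ≤ 2 * V := by
  classical
  ext s
  simp only [sigmaSet, mem_sigma, mem_filter, and_assoc]

/-- `g_S = 0` off `V < N(S) ≤ 2V`. [folklore] -/
theorem gCut_eq_zero_of_not {S : Ideal (𝓞 K)}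
    (h : ¬ (V < (Ideal.absNorm S : ℝ) ∧ (Ideal.absNorm S : ℝ) ≤ 2 * V)) : gCut X τ m V S = 0 := by
  rw [gCut, if_neg h]

open scoped Classical in
/-- **`M_V = ∑_{α̂ ∈ Abox} c_{(α)}[α̂ primitive] ∑_{β̂ ∈ Bbox} F_β W(α̂β̂)`** — Heath-Brown's
"`S_V = ∑_{α ∈ Q} c_{(α)} ∑_{V<|N(β)|≤2V} F_β ∑_{𝐱 ∈ ℤ², x + y2^{1/3} = αβ} W(𝐱) + O(…)`" for the main
term, via the re-indexing bijection. [cite: HeathBrownActa2001, §11 p. 68] -/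
theorem mainMV_eq_sum_cA_innerSum (hX : 0 < X) (hη1 : η ≤ 1) (hT : 0 < T) (hTV : T ^ 3 = V) :
    mainMV X τ m V T c η = ∑ a ∈ Abox X T, cA c a * innerSum X η τ m V T a := by
  classical
  -- the left side over `sigmaSet`
  set Φ : (_ : ℕ × ℕ) × 𝓞 K → ℝ := fun s =>
    if IsPrimitiveVec (coordVec s.2) ∧ IsPrimitiveVec (coordVec (quo (pairElt s.1) s.2)) then
      c (Ideal.span {quo (pairElt s.1) s.2}) * gCut X τ m V (Ideal.span {s.2}) else 0 with hΦ
  have hL : mainMV X τ m V T c η = ∑ s ∈ sigmaSet X η V T, Φ s := by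
    rw [mainMV, sigmaSet_eq_filter, sum_filter_of_ne, sum_sigma]
    · rfl
    · rintro ⟨xy, β⟩ _ hne
      by_contra hnot
      apply hne
      simp only [hΦ]
      rw [gCut_eq_zero_of_not hnot]
      simp
  -- the right side over `pairSet`
  set G : (ℤ × ℤ × ℤ) × (ℤ × ℤ × ℤ) → ℝ := fun ab =>
    cA c ab.1 * (if Wab X η ab.1 ab.2 then Fb X τ m V T ab.2 else 0) with hG
  have hR : ∑ a ∈ Abox X T, cA c a * innerSum X η τ m V T a = ∑ ab ∈ pairSet X η V T, G ab := by
    rw [pairSet, sum_filter_of_ne, sum_product]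
    · simp only [innerSum, mul_sum]
      rfl
    · rintro ⟨a, b⟩ _ hne
      simp only [hG] at hne
      have hW : Wab X η a b := by by_contra h; rw [if_neg h, mul_zero] at hne; exact hne rfl
      rw [if_pos hW] at hne
      have hF : Fb X τ m V T b ≠ 0 := fun h => by rw [h, mul_zero] at hne; exact hne rfl
      rw [Fb] at hF
      have hw : InWindow T (coordElt b) ∧ IsPrimitiveVec b := by
        by_contra h; rw [if_neg h] at hF; exact hF rfl
      rw [if_pos hw] at hF
      have hN : V < (Ideal.absNorm (Ideal.span {coordElt b}) : ℝ) ∧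
          (Ideal.absNorm (Ideal.span {coordElt b}) : ℝ) ≤ 2 * V := by
        by_contra h; exact hF (gCut_eq_zero_of_not h)
      exact ⟨hW, hw.1, hN⟩
  rw [hL, hR, sum_pairSet_eq_sum_sigmaSet hX hη1 hT hTV]
  refine sum_congr rfl fun s hs => ?_
  have hmem := phiMap_mem_pairSet hX hη1 hT hTV hs
  rw [mem_pairSet_iff] at hmem
  obtain ⟨-, hW, hw, -, -⟩ := hmem
  simp only [hG, hΦ, cA, Fb]
  rw [if_pos hW]
  have ha : coordElt (phiMap s).1 = quo (pairElt s.1) s.2 := by rw [phiMap]; exact coordElt_coordVec _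
  have hb : coordElt (phiMap s).2 = s.2 := by rw [phiMap]; exact coordElt_coordVec _
  have ha' : (phiMap s).1 = coordVec (quo (pairElt s.1) s.2) := rfl
  have hb' : (phiMap s).2 = coordVec s.2 := rfl
  rw [ha, hb, ha', hb']
  rw [hb] at hw
  by_cases h1 : IsPrimitiveVec (coordVec (quo (pairElt s.1) s.2)) <;>
    by_cases h2 : IsPrimitiveVec (coordVec s.2) <;> simp [h1, h2, hw]

/-! ### Cauchy's inequality -/

open scoped Classical in
/-- **Cauchy's inequality** (p. 68): `|∑_α c_α ∑_β F_β W(αβ)| ≤ (#Abox)^{1/2} S^{1/2}` (`|c_α| ≤ 1`,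
and `c_α = 0` unless `α̂` is primitive). [cite: HeathBrownActa2001, §11 p. 68] -/
theorem abs_sum_cA_innerSum_le (hc : CSupport X τ c) :
    |∑ a ∈ Abox X T, cA c a * innerSum X η τ m V T a| ≤
      Real.sqrt (#(Abox X T)) * Real.sqrt (Ssum X η τ m V T) := by
  classical
  set F := (Abox X T).filter IsPrimitiveVec with hF
  have h1 : ∑ a ∈ Abox X T, cA c a * innerSum X η τ m V T a =
      ∑ a ∈ F, c (Ideal.span {coordElt a}) * innerSum X η τ m V T a := by
    rw [hF, sum_filter]
    refine sum_congr rfl fun a _ => ?_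
    simp only [cA]; split_ifs <;> simp
  rw [h1]
  have h2 : |∑ a ∈ F, c (Ideal.span {coordElt a}) * innerSum X η τ m V T a| ≤
      ∑ a ∈ F, |innerSum X η τ m V T a| := by
    refine (abs_sum_le_sum_abs _ _).trans (sum_le_sum fun a _ => ?_)
    rw [abs_mul]
    have : |c (Ideal.span {coordElt a})| ≤ 1 := by
      rcases hc.1 (Ideal.span {coordElt a}) with h | h <;> rw [h] <;> norm_num
    calc |c (Ideal.span {coordElt a})| * |innerSum X η τ m V T a| ≤ 1 * |innerSum X η τ m V T a| :=
          mul_le_mul_of_nonneg_right this (abs_nonneg _)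
      _ = |innerSum X η τ m V T a| := one_mul _
  refine h2.trans ?_
  have h3 := Real.sum_mul_le_sqrt_mul_sqrt F (fun a => |innerSum X η τ m V T a|) (fun _ => (1 : ℝ))
  simp only [sq_abs, one_pow, sum_const, nsmul_eq_mul, mul_one] at h3
  refine h3.trans ?_
  rw [mul_comm, Ssum, ← hF]
  gcongr
  rw [hF]; exact filter_subset _ _

/-- `#Abox ≤ (14X/T + 1)³` ("`N(α) ≪ X³/V`"). [cite: HeathBrownActa2001, §11 p. 68] -/
theorem card_Abox_le (hX : 0 ≤ X) (hT : 0 < T) : (#(Abox X T) : ℝ) ≤ (14 * X / T + 1) ^ 3 := by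
  rw [Abox]
  refine (card_cube_le (by positivity)).trans (le_of_eq ?_)
  ring

/-! ### `S = S₁ + S₂` and the bound for `S₁` -/

open scoped Classical in
/-- **`S = S₁ + S₂`**: expand the square and split the diagonal `β₁ = β₂` from `β₁ ≠ β₂`.
[cite: HeathBrownActa2001, §11 p. 68] -/
theorem Ssum_eq_S1_add_S2 : Ssum X η τ m V T = S1sum X η τ m V T + S2sum X η τ m V T := by
  classical
  rw [Ssum, S1sum, S2sum, ← sum_add_distrib]
  refine sum_congr rfl fun a _ => ?_
  set G : ℤ × ℤ × ℤ → ℝ := fun b => if Wab X η a b then Fb X τ m V T b else 0 with hG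
  have hsq : innerSum X η τ m V T a ^ 2 = ∑ bb ∈ Bbox T ×ˢ Bbox T, G bb.1 * G bb.2 := by
    rw [innerSum, sq, sum_mul_sum, sum_product]
  rw [hsq, ← diag_union_offDiag, sum_union (disjoint_diag_offDiag _)]
  congr 1
  · -- diagonal
    rw [diag, sum_map]
    refine sum_congr rfl fun b _ => ?_
    simp only [hG, Function.Embedding.coeFn_mk]
    split_ifs <;> ring
  · refine sum_congr rfl fun bb _ => ?_
    simp only [hG]
    split_ifs <;> simp_all

open scoped Classical in
/-- `F_β² ≤ 81 τ((β))²`. [cite: HeathBrownActa2001, §11 p. 68] -/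
theorem Fb_sq_le (hX : 1 < X) (hτ : 0 < τ) (hτ1 : τ ≤ 1) {n : ℕ} {m : Fin (n + 1) → ℕ}
    (hm : CoreAdmissible τ m) (b : ℤ × ℤ × ℤ) :
    Fb X τ m V T b ^ 2 ≤ 81 * (idealDivisorCount (Ideal.span {coordElt b}) : ℝ) ^ 2 := by
  have h : |Fb X τ m V T b| ≤ 9 * (idealDivisorCount (Ideal.span {coordElt b}) : ℝ) := by
    rw [Fb]
    split_ifs
    · exact abs_gCut_le hX hτ hτ1 hm V _
    · rw [abs_zero]; positivity
  calc Fb X τ m V T b ^ 2 = |Fb X τ m V T b| ^ 2 := (sq_abs _).symm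
    _ ≤ (9 * (idealDivisorCount (Ideal.span {coordElt b}) : ℝ)) ^ 2 := pow_le_pow_left₀ (abs_nonneg _) h 2
    _ = 81 * (idealDivisorCount (Ideal.span {coordElt b}) : ℝ) ^ 2 := by ring

open scoped Classical in
/-- **`S₁ ≤ 81 ∑_{(x,y) ∈ box} τ((x + y2^{1/3}))³`** ("`S₁ ≪ ∑_β F_β² ∑_𝐱 W(𝐱) ≪ … ∑ τ(x+y2^{1/3})³`",
p. 68: each `(α̂, β̂)` with `W(α̂β̂)` comes from a pair `(x, y)` and a `β ∣ x + y2^{1/3}`, and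
`∑_{β ∣ γ} τ(β)² ≤ τ(γ)³`). [cite: HeathBrownActa2001, §11 p. 68] -/
theorem S1sum_le (hX : 1 < X) (hη1 : η ≤ 1) (hτ : 0 < τ) (hτ1 : τ ≤ 1) {n : ℕ} {m : Fin (n + 1) → ℕ}
    (hm : CoreAdmissible τ m) (hT : 0 < T) (hTV : T ^ 3 = V) :
    S1sum X η τ m V T ≤ 81 * ∑ xy ∈ box X η, (idealDivisorCount (Ideal.span {pairElt xy}) : ℝ) ^ 3 := by
  classical
  have hX0 : 0 < X := by linarith
  set G : (ℤ × ℤ × ℤ) × (ℤ × ℤ × ℤ) → ℝ := fun ab =>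
    if Wab X η ab.1 ab.2 then Fb X τ m V T ab.2 ^ 2 else 0 with hG
  have hG0 : ∀ ab, 0 ≤ G ab := fun ab => by simp only [hG]; split_ifs <;> positivity
  -- Step 1: drop the primitivity of `α̂` and pass to `pairSet`
  have h1 : S1sum X η τ m V T ≤ ∑ ab ∈ pairSet X η V T, G ab := by
    rw [S1sum]
    calc ∑ a ∈ (Abox X T).filter IsPrimitiveVec, ∑ b ∈ Bbox T, (if Wab X η a b then Fb X τ m V T b ^ 2 else 0)
        ≤ ∑ a ∈ Abox X T, ∑ b ∈ Bbox T, (if Wab X η a b then Fb X τ m V T b ^ 2 else 0) :=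
          sum_le_sum_of_subset_of_nonneg (filter_subset _ _) fun a _ _ =>
            sum_nonneg fun b _ => hG0 (a, b)
      _ = ∑ ab ∈ Abox X T ×ˢ Bbox T, G ab := by rw [sum_product]
      _ = ∑ ab ∈ pairSet X η V T, G ab := by
          rw [pairSet, sum_filter_of_ne]
          rintro ⟨a, b⟩ _ hne
          simp only [hG] at hne
          have hW : Wab X η a b := by by_contra h; rw [if_neg h] at hne; exact hne rfl
          rw [if_pos hW] at hne
          have hF : Fb X τ m V T b ≠ 0 := fun h => by rw [h] at hne; exact hne (by ring)
          rw [Fb] at hF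
          have hw : InWindow T (coordElt b) ∧ IsPrimitiveVec b := by
            by_contra h; rw [if_neg h] at hF; exact hF rfl
          rw [if_pos hw] at hF
          have hN : V < (Ideal.absNorm (Ideal.span {coordElt b}) : ℝ) ∧
              (Ideal.absNorm (Ideal.span {coordElt b}) : ℝ) ≤ 2 * V := by
            by_contra h; exact hF (gCut_eq_zero_of_not h)
          exact ⟨hW, hw.1, hN⟩
  -- Step 2: re-index and bound termwise by `81 τ((γ))²`
  have h2 : ∑ ab ∈ pairSet X η V T, G ab ≤
      ∑ s ∈ sigmaSet X η V T, 81 * (idealDivisorCount (Ideal.span {pairElt s.1}) : ℝ) ^ 2 := by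
    rw [sum_pairSet_eq_sum_sigmaSet hX0 hη1 hT hTV]
    refine sum_le_sum fun s hs => ?_
    have hs' := hs
    rw [mem_sigmaSet_iff hX0.le hT] at hs'
    obtain ⟨hxy, -, hdvd, -, -⟩ := hs'
    have hx1 := (one_le_of_mem_box hX0.le hxy).1
    have hγ : Ideal.span {pairElt s.1} ≠ ⊥ := by
      rw [Ne, Ideal.span_singleton_eq_bot]; exact pairElt_ne_zero (by omega)
    simp only [hG]
    have hb : coordElt (phiMap s).2 = s.2 := by rw [phiMap]; exact coordElt_coordVec _
    split_ifs
    · calc Fb X τ m V T (phiMap s).2 ^ 2 ≤ 81 * (idealDivisorCount (Ideal.span {coordElt (phiMap s).2}) : ℝ) ^ 2 :=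
            Fb_sq_le hX hτ hτ1 hm _
        _ ≤ 81 * (idealDivisorCount (Ideal.span {pairElt s.1}) : ℝ) ^ 2 := by
            rw [hb]
            gcongr
            exact_mod_cast idealDivisorCount_le_of_dvd hγ
              (Ideal.dvd_iff_le.mpr (Ideal.span_singleton_le_span_singleton.mpr hdvd))
    · positivity
  -- Step 3: enlarge to the full sigma-set and count the `β`'s
  have h3 : ∑ s ∈ sigmaSet X η V T, 81 * (idealDivisorCount (Ideal.span {pairElt s.1}) : ℝ) ^ 2 ≤
      81 * ∑ xy ∈ box X η, (idealDivisorCount (Ideal.span {pairElt xy}) : ℝ) ^ 3 := by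
    calc ∑ s ∈ sigmaSet X η V T, 81 * (idealDivisorCount (Ideal.span {pairElt s.1}) : ℝ) ^ 2
        ≤ ∑ s ∈ (box X η).sigma (fun xy => winDivs T (pairElt xy)),
            81 * (idealDivisorCount (Ideal.span {pairElt s.1}) : ℝ) ^ 2 := by
          rw [sigmaSet_eq_filter]
          exact sum_le_sum_of_subset_of_nonneg (filter_subset _ _) fun _ _ _ => by positivity
      _ = ∑ xy ∈ box X η, #(winDivs T (pairElt xy)) * (81 * (idealDivisorCount (Ideal.span {pairElt xy}) : ℝ) ^ 2) := by
          rw [sum_sigma]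
          refine sum_congr rfl fun xy _ => ?_
          dsimp only
          rw [sum_const, nsmul_eq_mul]
      _ ≤ ∑ xy ∈ box X η, (idealDivisorCount (Ideal.span {pairElt xy}) : ℝ) *
            (81 * (idealDivisorCount (Ideal.span {pairElt xy}) : ℝ) ^ 2) := by
          gcongr with xy hxy
          exact_mod_cast card_winDivs_le T (pairElt xy)
      _ = 81 * ∑ xy ∈ box X η, (idealDivisorCount (Ideal.span {pairElt xy}) : ℝ) ^ 3 := by
          rw [mul_sum]; refine sum_congr rfl fun xy _ => ?_; ring
  exact h1.trans (h2.trans h3)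

/-- **`S₁ ≪ X² (log X)^c`** (p. 68, by Lemma 4.7): absolute `C, e` with `S₁ ≤ C X² (log X)^e` for
`X ≥ 2`, `0 ≤ η ≤ 1`, `0 < τ ≤ 1`, `T > 0`, `T³ = V`, `𝐦` admissible. [cite: HeathBrownActa2001, §11 p. 68] -/
theorem exists_S1_bound :
    ∃ C e : ℝ, 0 < C ∧ 0 ≤ e ∧ ∀ (X η τ V T : ℝ) (n : ℕ) (m : Fin (n + 1) → ℕ),
      2 ≤ X → 0 ≤ η → η ≤ 1 → 0 < τ → τ ≤ 1 → 0 < T → T ^ 3 = V → CoreAdmissible τ m →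
        S1sum X η τ m V T ≤ C * X ^ 2 * Real.log X ^ e := by
  classical
  obtain ⟨C₃, e₃, hC₃, he₃, h47⟩ := HeathBrown2001_lemma_4_7 3
  refine ⟨81 * (C₃ * 4 * 4 ^ e₃), e₃, by positivity, he₃, ?_⟩
  intro X η τ V T n m hX hη0 hη1 hτ hτ1 hT hTV hm
  have hX1 : 1 < X := by linarith
  have hX0 : 0 ≤ X := by linarith
  set N : ℕ := ⌊X * (1 + η)⌋₊ with hN
  have hNX : (N : ℝ) ≤ 2 * X := by
    have : (N : ℝ) ≤ X * (1 + η) := Nat.floor_le (by positivity)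
    nlinarith
  have hN2 : 2 ≤ N := Nat.le_floor (by push_cast; nlinarith)
  have hlogX : 0 < Real.log X := Real.log_pos hX1
  have hlog2 : Real.log 2 ≤ Real.log X := Real.log_le_log two_pos hX
  have hlogNN : Real.log ((N : ℝ) * N) ≤ 4 * Real.log X := by
    have hlogN : Real.log N ≤ 2 * Real.log X := by
      calc Real.log N ≤ Real.log (2 * X) := Real.log_le_log (by positivity) hNX
        _ = Real.log 2 + Real.log X := Real.log_mul two_ne_zero (by positivity)
        _ ≤ 2 * Real.log X := by linarith
    rw [Real.log_mul (by positivity) (by positivity)]; linarith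
  have hN2r : (2 : ℝ) ≤ N := by exact_mod_cast hN2
  have hlogNN0 : 0 ≤ Real.log ((N : ℝ) * N) := Real.log_nonneg (by nlinarith)
  refine (S1sum_le hX1 hη1 hτ hτ1 hm hT hTV).trans ?_
  have hA := (sum_box_idealDivisorCount_pow_le (η := η) 3 hX0).trans (h47 N N hN2 le_rfl)
  calc 81 * ∑ xy ∈ box X η, (idealDivisorCount (Ideal.span {pairElt xy}) : ℝ) ^ 3
      ≤ 81 * (C₃ * N * N * Real.log ((N : ℝ) * N) ^ e₃) := by gcongr
    _ ≤ 81 * (C₃ * (2 * X) * (2 * X) * (4 * Real.log X) ^ e₃) := by gcongr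
    _ = 81 * (C₃ * 4 * 4 ^ e₃) * X ^ 2 * Real.log X ^ e₃ := by
        rw [Real.mul_rpow (by norm_num) hlogX.le]; ring

end Literature.NumberTheory.Sieve.CubicSieve

end
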